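import Summits.CriticalPhenomena.CardyFormulaZ2.Theorems.CardyBondTriangularSwitchingReductionFormats
import Summits.CriticalPhenomena.CardyFormulaZ2.Theorems.CardyBondTriangularSwitchingReductionSignedCauchy

/-!
# Route CardyBondTriangular — separating data for bond-𝕋 from the crux `MesoscopicColourSwitching`

Support of the informal route item `SwitchingReduction` (stmt-CriticalPhenomena-5004):
"MesoscopicColourSwitching (summed form) ∧ the Bollobás–Riordan percolation inputs for critical
bond-𝕋 … together with the tree's PROVED Lemma-14 discrete domains ⇒ the hypothesis of
`SeparatingDataToCardy`". This file discharges the part of that implication which is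
bookkeeping, against the crux AS TYPED in the route file
(`Summit.CriticalPhenomena.CardyFormulaZ2.Theses.CardyBondTriangular.MesoscopicColourSwitching`:
the signed weighted colour-switching defect of the Chayes–Lei separating probabilities
`clSepDiffProb triBondCritical` of `(G δ).dropLast`, summed over the faces of the domain with
vertices in the solid triangle of any lattice triangular contour in a compact `K ⊆ Ω`, is
`≤ n δ e(δ)` with `e → 0`):

* `exists_isSeparatingData_of_mesoscopicColourSwitching` — for a discrete approximation `G` of
  `R` (`IsDiscreteApprox`, the geometry of Bollobás–Riordan's Lemma 14), the crux together with
  the three remaining percolation inputs in the tree's formats — (12) three-arm smallness of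
  `clSepDiffProb` on compacta, the equicontinuity estimate of p. 198 along short dual chains,
  the boundary values of pp. 200–201 — gives discrete separating data (`IsSeparatingData`,
  `ω = ζ²`) reading `clSepProb triBondCritical` at the face centres of `G_δ`. The discrete Cauchy
  clause is `norm_discreteTriangleIntegral_sub_mul_le_signed` (defect
  `6 n δ ε_K + |2ζ - 1| n δ e`), the faces with vertices in the solid triangle being triangles of
  `G_δ` by the filling of `K`; (10) is `clSepProb_sub_clSepProb`.
* `exists_separatingData_triBond_of_mesoscopicColourSwitching` — with an inner and an outer
  approximation and the sandwich ((19)/(40)) of a crossing-probability function `Q` (for the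
  route: the crude bond-𝕋 crossing probability at mesh `δ/√3`), LITERALLY the datum-wise
  hypothesis of `SeparatingDataToCardy` for an anticlockwise Carleson datum (`ω = ζ²`).

What is then left of `SwitchingReduction` is percolation for the Chayes–Lei model: (12) (Claim 10
+ an annulus bound), p. 198, pp. 200–201 (duality), and the sandwich for `embDomainCrossing`.

## References

* B. Bollobás, O. Riordan, *Percolation*, Cambridge University Press (2006), Ch. 7 §7.2.4–7.2.6:
  (9)–(10) p. 180, Lemma 13 pp. 181–182, Lemma 14 p. 184 with (19), pp. 196–203 with (40).
* L. Chayes, H. K. Lei, *Cardy's formula for certain models of the bond-triangular type*,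
  Rev. Math. Phys. 19 (2007) 511–565, §2.1–2.3.
-/

noncomputable section

namespace Summit.CriticalPhenomena.CardyFormulaZ2.Theorems

open Set Filter Topology Metric
open Literature.Probability.Percolation Literature.Probability.RandomPlanarGeometry
open Literature.Probability.RandomPlanarGeometry.MarkedDomain
open Literature.Probability.LatticeModels

/-! ### Separating data for bond-𝕋 from the route's crux `MesoscopicColourSwitching` -/

/-- **Separating data for critical bond percolation on `𝕋` from `MesoscopicColourSwitching`.**
Let `G_δ` be a discrete approximation of the conformal rectangle `R` and let
`fⁱ_δ = clSepProb`, `hⁱ_δ = clSepDiffProb` be the Bollobás–Riordan separating probabilities of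
the 3-marked domains `(G δ).dropLast` for the Chayes–Lei hexagon representation of critical
bond percolation on `𝕋` (`ChayesLeiHexPercolation.triBondCritical`). Assume the route's crux
`MesoscopicColourSwitching` (the signed, weighted colour-switching defect summed over the faces
inside any lattice triangular contour in a compact `K ⊆ Ω` is `≤ n δ e(δ)`, `e → 0`), the
three-arm smallness (12) of `h` on compacta, the equicontinuity estimate of p. 198 and the
boundary values of pp. 200–201. Then the face centres of `G_δ` and a plane function reading
`clSepProb` at the face centres are discrete separating data for `R` with `ω = ζ²`: the
discrete Cauchy clause is `norm_discreteTriangleIntegral_sub_mul_le_signed` — defect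
`6 n δ ε_K(δ) + |2ζ - 1| n δ e(δ)`, the faces with vertices in the solid triangle being
triangles of `G_δ` by the filling of `K` — and the other clauses are those of
`exists_isSeparatingData_of_approxSwitching`. [cite: BollobasRiordan2006, Ch. 7 §7.2.6 pp. 196–201, Lemma 13 pp. 181–182] -/
theorem exists_isSeparatingData_of_mesoscopicColourSwitching
    (hMCS : Summit.CriticalPhenomena.CardyFormulaZ2.Theses.CardyBondTriangular.MesoscopicColourSwitching)
    {R : ConformalRectangle} {G : ℝ → TriMarkedDomain 4} (hG : IsDiscreteApprox R G)
    (h12 : ∀ K : Set ℂ, IsCompact K → K ⊆ R.carrier → ∃ ε : ℝ → ℝ, Tendsto ε (𝓝[>] 0) (𝓝 0) ∧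
      ∀ᶠ δ : ℝ in 𝓝[>] 0, ∀ w : HexVertex, (δ : ℂ) * hexCenter w ∈ K → ∀ i j : Fin 3,
        (G δ).dropLast.clSepDiffProb ChayesLeiHexPercolation.triBondCritical i w (oppFace w j) ≤ ε δ)
    (h198 : ∀ β > (0 : ℝ), ∃ γ > (0 : ℝ), ∀ᶠ δ : ℝ in 𝓝[>] 0, ∀ (i : Fin 3) (w z : HexVertex),
      w ∈ (G δ).faces → Relation.ReflTransGen (fun x y : HexVertex => hexGraph.Adj x y ∧
        y ∈ (G δ).faces ∧ dist ((δ : ℂ) * hexCenter w) ((δ : ℂ) * hexCenter y) < 2 * γ) w z →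
        (G δ).dropLast.clSepProb ChayesLeiHexPercolation.triBondCritical i z -
          (G δ).dropLast.clSepProb ChayesLeiHexPercolation.triBondCritical i w ≤ β)
    (h200 : ∀ (i : Fin 3), ∀ z ∈ (forgetLast R).boundary ''
        Ioo ((forgetLast R).mark i) ((forgetLast R).nextMark i),
      ∃ zs : ℝ → HexVertex,
        (∀ᶠ δ in 𝓝[>] (0 : ℝ), zs δ ∈ (G δ).faces ∧ (δ : ℂ) * hexCenter (zs δ) ∈ R.carrier) ∧
          Tendsto (fun δ : ℝ => (δ : ℂ) * hexCenter (zs δ)) (𝓝[>] 0) (𝓝 z) ∧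
            Tendsto (fun δ => (G δ).dropLast.clSepProb ChayesLeiHexPercolation.triBondCritical i (zs δ))
              (𝓝[>] 0) (𝓝 0) ∧
              Tendsto (fun δ => (G δ).dropLast.clSepProb ChayesLeiHexPercolation.triBondCritical (i + 1) (zs δ) +
                (G δ).dropLast.clSepProb ChayesLeiHexPercolation.triBondCritical (i + 2) (zs δ))
                (𝓝[>] 0) (𝓝 1)) :
    ∃ f : ℝ → Fin 3 → ℂ → ℝ,
      (∀ δ, δ ≠ 0 → ∀ i w, f δ i ((δ : ℂ) * hexCenter w) =
        (G δ).dropLast.clSepProb ChayesLeiHexPercolation.triBondCritical i w) ∧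
        IsSeparatingData R triOmega (fun δ => ((G δ).faces).image fun w => (δ : ℂ) * hexCenter w) f := by
  set M : ChayesLeiHexPercolation := ChayesLeiHexPercolation.triBondCritical with hM
  set F : ℝ → Fin 3 → HexVertex → ℝ := fun δ i w => (G δ).dropLast.clSepProb M i w with hFdef
  set g : ℝ → Fin 3 → HexVertex → HexVertex → ℝ := fun δ i w z => (G δ).dropLast.clSepDiffProb M i w z
    with hgdef
  have hF : ∀ δ i w, F δ i w ∈ Icc (0 : ℝ) 1 := fun δ i w =>
    ⟨MeasureTheory.measureReal_nonneg, MeasureTheory.measureReal_le_one⟩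
  have h10 : ∀ δ (i : Fin 3) (w : HexVertex) (j : Fin 3),
      F δ i (oppFace w j) - F δ i w = g δ i w (oppFace w j) - g δ i (oppFace w j) w :=
    fun δ i w j => (G δ).dropLast.clSepProb_sub_clSepProb M i w (oppFace w j)
  obtain ⟨f, hf, hf01⟩ := exists_faceExtension F hF
  refine ⟨f, hf, ?_⟩
  -- the rate of the crux and the exhaustion `K_m` of `Ω` with the rates of (12)
  obtain ⟨e, he, hMCS'⟩ := hMCS R G hG
  obtain ⟨Km, hKm⟩ : ∃ Km : ℕ → Set ℂ, ∀ m, Km m = {z : ℂ | 1 / ((m : ℝ) + 1) ≤ infDist z R.carrierᶜ} :=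
    ⟨_, fun _ => rfl⟩
  have hKc : ∀ m, IsCompact (Km m) ∧ Km m ⊆ R.carrier := fun m => by
    rw [hKm]; exact isCompact_deep R (by positivity)
  choose ε hε hεK using fun m => h12 (Km m) (hKc m).1 (hKc m).2
  obtain ⟨em, hem⟩ : ∃ em : ℕ → ℝ → ℝ, ∀ m δ, em m δ = 6 * |ε m δ| + ‖2 * triZeta - 1‖ * |e δ| :=
    ⟨_, fun _ _ => rfl⟩
  have hem0 : ∀ m, Tendsto (em m) (𝓝[>] 0) (𝓝 0) := by
    intro m
    have h1 := ((hε m).abs.const_mul 6).add (he.abs.const_mul ‖2 * triZeta - 1‖)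
    simp only [abs_zero, mul_zero, add_zero] at h1
    exact h1.congr fun δ => (hem m δ).symm
  obtain ⟨E, hE, hEe⟩ := exists_rate_dominating em hem0
  exact
  { mem_Icc := fun δ i w _ => hf01 δ i w
    dense := by
      obtain ⟨ε', hε', h⟩ := hG.dense
      refine ⟨ε', hε', h.mono fun δ hδ z hz => ?_⟩
      obtain ⟨w, hw, hd⟩ := hδ z hz
      exact ⟨_, Finset.mem_image_of_mem _ hw, hd⟩
    interior := fun K hK hKΩ => by
      obtain ⟨κ, hκ, hK'⟩ := hK.exists_cthickening_subset_open R.isOpen hKΩ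
      have hfill := hG.fill (cthickening κ K) hK.cthickening hK'
      have hsmall : ∀ᶠ δ in 𝓝[>] (0 : ℝ), δ ∈ Ioc 0 κ := Ioc_mem_nhdsGT hκ
      filter_upwards [hfill, hsmall] with δ hfill hδ x hxK
      refine Finset.mem_image_of_mem _ (((G δ).mem_faces).2 fun v hv => hfill v ?_)
      refine mem_cthickening_of_dist_le _ _ _ _ hxK ?_
      exact (dist_triMeshPoint_hexCenter_le hv δ).trans (by rw [abs_of_pos hδ.1]; exact hδ.2)
    equicontinuous := fun β hβ => by
      obtain ⟨γ, hγ, h198'⟩ := h198 β hβ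
      obtain ⟨θ, hθ, hloc⟩ := hG.local_conn γ hγ
      refine ⟨θ, hθ, ?_⟩
      filter_upwards [hloc, h198', self_mem_nhdsWithin] with δ hloc h198' hδ i z hz w hw hzw
      obtain ⟨Z, hZ, rfl⟩ := Finset.mem_image.1 hz
      obtain ⟨W, hW, rfl⟩ := Finset.mem_image.1 hw
      have hδ0 : δ ≠ 0 := ne_of_gt hδ
      rw [hf δ hδ0, hf δ hδ0]
      exact h198' i W Z hW (hloc W hW Z hZ (by rw [dist_comm]; exact hzw))
    cauchy := by
      classical
      refine ⟨E, hE, fun K hK hKΩ => ?_⟩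
      obtain ⟨m, hm⟩ := exists_subset_deep R hK hKΩ
      rw [← hKm] at hm
      filter_upwards [hεK m, hMCS' (Km m) (hKc m).1 (hKc m).2, hG.fill (Km m) (hKc m).1 (hKc m).2,
        hEe m, self_mem_nhdsWithin] with δ h12' hb hfill hEδ hδ i x₀ n s hs hT
      have hδpos : 0 < δ := hδ
      have hδ0 : δ ≠ 0 := ne_of_gt hδpos
      have hTK := hT.trans hm
      -- the faces with vertices in the solid triangle, as booked by the crux
      obtain ⟨C, hC, hbC⟩ : ∃ C : Finset HexVertex,
          (∀ w : HexVertex, w ∈ C ↔ ∀ v ∈ hexFaceVertices w, triMeshPoint δ v ∈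
            convexHull ℝ ({triMeshPoint δ x₀, triMeshPoint δ x₀ + n * s,
              triMeshPoint δ x₀ + n * s * triZeta} : Set ℂ)) ∧
          ‖∑ w ∈ C, ∑ j : Fin 3, ((δ : ℂ) * hexCenter (oppFace w j) - (δ : ℂ) * hexCenter w) *
            ((g δ (i + 1) w (oppFace w (j + 1)) - g δ i w (oppFace w j) : ℝ) : ℂ)‖ ≤ n * δ * e δ := by
        refine ⟨_, fun w => ?_, hb i x₀ n s hs hTK⟩
        rw [Finset.mem_filter]
        constructor
        · exact fun h => h.2
        · intro h
          exact ⟨((G δ).dropLast.mem_faces).2 fun v hv => hfill v (hTK (h v hv)), h⟩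
      have key := norm_discreteTriangleIntegral_sub_mul_le_signed hδpos x₀ n hs (f δ) (g δ)
        (ε := |ε m δ|) hTK C hC
        (fun w _ j _ i => by rw [hf δ hδ0, hf δ hδ0]; exact h10 δ i w j)
        (fun w hw i j => by
          have h0 : 0 ≤ g δ i w (oppFace w j) := MeasureTheory.measureReal_nonneg
          rw [abs_of_nonneg h0]
          exact (h12' w hw i j).trans (le_abs_self _)) i
      have hn0 : (0 : ℝ) ≤ n := n.cast_nonneg
      have hrate : 6 * n * δ * |ε m δ| + ‖2 * triZeta - 1‖ *
          ‖∑ w ∈ C, ∑ j : Fin 3, ((δ : ℂ) * hexCenter (oppFace w j) - (δ : ℂ) * hexCenter w) *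
            ((g δ (i + 1) w (oppFace w (j + 1)) - g δ i w (oppFace w j) : ℝ) : ℂ)‖ ≤
          n * δ * em m δ := by
        rw [hem]
        have h1 : (n : ℝ) * δ * e δ ≤ n * δ * |e δ| :=
          mul_le_mul_of_nonneg_left (le_abs_self _) (mul_nonneg hn0 hδpos.le)
        have h2 := mul_le_mul_of_nonneg_left (hbC.trans h1) (norm_nonneg (2 * triZeta - 1))
        nlinarith [h2, abs_nonneg (ε m δ)]
      calc _ ≤ _ := key
        _ ≤ n * δ * em m δ := hrate
        _ ≤ n * δ * E δ := mul_le_mul_of_nonneg_left hEδ (mul_nonneg hn0 hδpos.le)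
    boundary := fun i z hz => by
      obtain ⟨zs, hzs, hzt, hf0, hf1⟩ := h200 i z hz
      have hpos : ∀ᶠ δ in 𝓝[>] (0 : ℝ), δ ≠ 0 :=
        (eventually_mem_nhdsWithin).mono fun δ hδ => ne_of_gt hδ
      refine ⟨fun δ => (δ : ℂ) * hexCenter (zs δ), hzs.mono fun δ hδ =>
        ⟨Finset.mem_image_of_mem _ hδ.1, hδ.2⟩, hzt, ?_, ?_⟩
      · exact hf0.congr' (hpos.mono fun δ hδ => (hf δ hδ i (zs δ)).symm)
      · refine hf1.congr' (hpos.mono fun δ hδ => ?_)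
        beta_reduce
        rw [hf δ hδ, hf δ hδ] }

/-- **The same, with (12) and the estimate of p. 198 in Bollobás–Riordan's printed formats**:
(12) as a three-arm bound `h ≤ A (δ/a)^α` at the triangles of `G_δ` whose centre is `≥ a > 2000 δ`
away from one discrete arc (p. 181, via Claim 10 and an annulus bound with exponent `α > 0`), and
p. 198 as `f(z') - f(w') ≤ 2 (3γ/(c/2))^α` along dual chains inside `B_{2γ}(w')` when every point
is `≥ c` from some discrete arc (`12γ ≤ c`, `1000δ ≤ 3γ`); converted by
`approxSwitching_small_of_armBound` and `approxSwitching_equi_of_dualPath`.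
[cite: BollobasRiordan2006, Ch. 7 (12) p. 181, proof of Claim 22 p. 198] -/
theorem exists_isSeparatingData_of_mesoscopicColourSwitching_of_armBound
    (hMCS : Summit.CriticalPhenomena.CardyFormulaZ2.Theses.CardyBondTriangular.MesoscopicColourSwitching)
    {R : ConformalRectangle} {G : ℝ → TriMarkedDomain 4} (hG : IsDiscreteApprox R G) {α : ℝ}
    (hα : 0 < α) (A : ℝ)
    (h12 : ∀ (δ a : ℝ), 0 < δ → 2000 * δ < a → ∀ w ∈ (G δ).faces,
      (∃ j : Fin 3, a ≤ infDist ((δ : ℂ) * hexCenter w) ((G δ).dropLast.arcPts δ j)) →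
        ∀ i j : Fin 3, (G δ).dropLast.clSepDiffProb ChayesLeiHexPercolation.triBondCritical i w
          (oppFace w j) ≤ A * (δ / a) ^ α)
    (h198 : ∀ (δ c γ : ℝ), 0 < δ → 0 < γ → 12 * γ ≤ c → 1000 * δ ≤ 3 * γ →
      (∀ w : ℂ, ∃ j : Fin 3, c ≤ infDist w ((G δ).dropLast.arcPts δ j)) →
        ∀ (i : Fin 3) (w' z' : HexVertex), w' ∈ (G δ).faces →
          Relation.ReflTransGen (fun x y : HexVertex => hexGraph.Adj x y ∧ y ∈ (G δ).faces ∧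
            dist ((δ : ℂ) * hexCenter w') ((δ : ℂ) * hexCenter y) < 2 * γ) w' z' →
            (G δ).dropLast.clSepProb ChayesLeiHexPercolation.triBondCritical i z' -
              (G δ).dropLast.clSepProb ChayesLeiHexPercolation.triBondCritical i w' ≤
                2 * (3 * γ / (c / 2)) ^ α)
    (h200 : ∀ (i : Fin 3), ∀ z ∈ (forgetLast R).boundary ''
        Ioo ((forgetLast R).mark i) ((forgetLast R).nextMark i),
      ∃ zs : ℝ → HexVertex,
        (∀ᶠ δ in 𝓝[>] (0 : ℝ), zs δ ∈ (G δ).faces ∧ (δ : ℂ) * hexCenter (zs δ) ∈ R.carrier) ∧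
          Tendsto (fun δ : ℝ => (δ : ℂ) * hexCenter (zs δ)) (𝓝[>] 0) (𝓝 z) ∧
            Tendsto (fun δ => (G δ).dropLast.clSepProb ChayesLeiHexPercolation.triBondCritical i (zs δ))
              (𝓝[>] 0) (𝓝 0) ∧
              Tendsto (fun δ => (G δ).dropLast.clSepProb ChayesLeiHexPercolation.triBondCritical (i + 1) (zs δ) +
                (G δ).dropLast.clSepProb ChayesLeiHexPercolation.triBondCritical (i + 2) (zs δ))
                (𝓝[>] 0) (𝓝 1)) :
    ∃ f : ℝ → Fin 3 → ℂ → ℝ,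
      (∀ δ, δ ≠ 0 → ∀ i w, f δ i ((δ : ℂ) * hexCenter w) =
        (G δ).dropLast.clSepProb ChayesLeiHexPercolation.triBondCritical i w) ∧
        IsSeparatingData R triOmega (fun δ => ((G δ).faces).image fun w => (δ : ℂ) * hexCenter w) f := by
  obtain ⟨ε, hε, hεK⟩ := approxSwitching_small_of_armBound hG
    (fun δ i w z => (G δ).dropLast.clSepDiffProb ChayesLeiHexPercolation.triBondCritical i w z) hα A
    (fun δ a hδ ha w hw hfar i j => by
      have h0 : 0 ≤ (G δ).dropLast.clSepDiffProb ChayesLeiHexPercolation.triBondCritical i w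
          (oppFace w j) := MeasureTheory.measureReal_nonneg
      rw [abs_of_nonneg h0]
      exact h12 δ a hδ ha w hw hfar i j)
  refine exists_isSeparatingData_of_mesoscopicColourSwitching hMCS hG (fun K hK hKΩ => ⟨ε, hε, ?_⟩)
    (approxSwitching_equi_of_dualPath hG
      (fun δ i w => (G δ).dropLast.clSepProb ChayesLeiHexPercolation.triBondCritical i w) hα h198)
    h200
  exact (hεK K hK hKΩ).mono fun δ hδ w hw i j => (le_abs_self _).trans (hδ w hw i j)

/-- **The switching reduction for one anticlockwise Carleson datum, from the crux as typed.**
Given the route's crux `MesoscopicColourSwitching`, an inner and an outer discrete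
approximation `G⁻`, `G⁺` of the conformal rectangle `R` each satisfying the three remaining
percolation inputs ((12), p. 198, pp. 200–201) for the Chayes–Lei separating probabilities of
critical bond-𝕋, and triangles `z∓_δ` of `G∓_δ` with centres in `Ω` tending to `d' = R.pt 3`
with the sandwich `f⁻¹_δ(z⁻_δ) - e(δ) ≤ Q(δ) ≤ f⁺¹_δ(z⁺_δ) + e(δ)` eventually (`e → 0`;
Bollobás–Riordan 2006, (19) p. 184 and (40) p. 201, p. 203), one has the datum-wise hypothesis
of the route item `SeparatingDataToCardy` with `ω = ζ²` and `Q` in place of the crude bond-𝕋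
crossing probability at mesh `δ/√3`. [cite: BollobasRiordan2006, Ch. 7 proof of Thm. 2 pp. 202–203] -/
theorem exists_separatingData_triBond_of_mesoscopicColourSwitching
    (hMCS : Summit.CriticalPhenomena.CardyFormulaZ2.Theses.CardyBondTriangular.MesoscopicColourSwitching)
    {R : ConformalRectangle} {Gm Gp : ℝ → TriMarkedDomain 4}
    (hGm : IsDiscreteApprox R Gm) (hGp : IsDiscreteApprox R Gp)
    (h12m : ∀ K : Set ℂ, IsCompact K → K ⊆ R.carrier → ∃ ε : ℝ → ℝ, Tendsto ε (𝓝[>] 0) (𝓝 0) ∧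
      ∀ᶠ δ : ℝ in 𝓝[>] 0, ∀ w : HexVertex, (δ : ℂ) * hexCenter w ∈ K → ∀ i j : Fin 3,
        (Gm δ).dropLast.clSepDiffProb ChayesLeiHexPercolation.triBondCritical i w (oppFace w j) ≤ ε δ)
    (h198m : ∀ β > (0 : ℝ), ∃ γ > (0 : ℝ), ∀ᶠ δ : ℝ in 𝓝[>] 0, ∀ (i : Fin 3) (w z : HexVertex),
      w ∈ (Gm δ).faces → Relation.ReflTransGen (fun x y : HexVertex => hexGraph.Adj x y ∧
        y ∈ (Gm δ).faces ∧ dist ((δ : ℂ) * hexCenter w) ((δ : ℂ) * hexCenter y) < 2 * γ) w z →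
        (Gm δ).dropLast.clSepProb ChayesLeiHexPercolation.triBondCritical i z -
          (Gm δ).dropLast.clSepProb ChayesLeiHexPercolation.triBondCritical i w ≤ β)
    (h200m : ∀ (i : Fin 3), ∀ z ∈ (forgetLast R).boundary ''
        Ioo ((forgetLast R).mark i) ((forgetLast R).nextMark i),
      ∃ zs : ℝ → HexVertex,
        (∀ᶠ δ in 𝓝[>] (0 : ℝ), zs δ ∈ (Gm δ).faces ∧ (δ : ℂ) * hexCenter (zs δ) ∈ R.carrier) ∧
          Tendsto (fun δ : ℝ => (δ : ℂ) * hexCenter (zs δ)) (𝓝[>] 0) (𝓝 z) ∧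
            Tendsto (fun δ => (Gm δ).dropLast.clSepProb ChayesLeiHexPercolation.triBondCritical i (zs δ))
              (𝓝[>] 0) (𝓝 0) ∧
              Tendsto (fun δ => (Gm δ).dropLast.clSepProb ChayesLeiHexPercolation.triBondCritical (i + 1) (zs δ) +
                (Gm δ).dropLast.clSepProb ChayesLeiHexPercolation.triBondCritical (i + 2) (zs δ))
                (𝓝[>] 0) (𝓝 1))
    (h12p : ∀ K : Set ℂ, IsCompact K → K ⊆ R.carrier → ∃ ε : ℝ → ℝ, Tendsto ε (𝓝[>] 0) (𝓝 0) ∧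
      ∀ᶠ δ : ℝ in 𝓝[>] 0, ∀ w : HexVertex, (δ : ℂ) * hexCenter w ∈ K → ∀ i j : Fin 3,
        (Gp δ).dropLast.clSepDiffProb ChayesLeiHexPercolation.triBondCritical i w (oppFace w j) ≤ ε δ)
    (h198p : ∀ β > (0 : ℝ), ∃ γ > (0 : ℝ), ∀ᶠ δ : ℝ in 𝓝[>] 0, ∀ (i : Fin 3) (w z : HexVertex),
      w ∈ (Gp δ).faces → Relation.ReflTransGen (fun x y : HexVertex => hexGraph.Adj x y ∧
        y ∈ (Gp δ).faces ∧ dist ((δ : ℂ) * hexCenter w) ((δ : ℂ) * hexCenter y) < 2 * γ) w z →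
        (Gp δ).dropLast.clSepProb ChayesLeiHexPercolation.triBondCritical i z -
          (Gp δ).dropLast.clSepProb ChayesLeiHexPercolation.triBondCritical i w ≤ β)
    (h200p : ∀ (i : Fin 3), ∀ z ∈ (forgetLast R).boundary ''
        Ioo ((forgetLast R).mark i) ((forgetLast R).nextMark i),
      ∃ zs : ℝ → HexVertex,
        (∀ᶠ δ in 𝓝[>] (0 : ℝ), zs δ ∈ (Gp δ).faces ∧ (δ : ℂ) * hexCenter (zs δ) ∈ R.carrier) ∧
          Tendsto (fun δ : ℝ => (δ : ℂ) * hexCenter (zs δ)) (𝓝[>] 0) (𝓝 z) ∧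
            Tendsto (fun δ => (Gp δ).dropLast.clSepProb ChayesLeiHexPercolation.triBondCritical i (zs δ))
              (𝓝[>] 0) (𝓝 0) ∧
              Tendsto (fun δ => (Gp δ).dropLast.clSepProb ChayesLeiHexPercolation.triBondCritical (i + 1) (zs δ) +
                (Gp δ).dropLast.clSepProb ChayesLeiHexPercolation.triBondCritical (i + 2) (zs δ))
                (𝓝[>] 0) (𝓝 1))
    {zm zp : ℝ → HexVertex} {e Q : ℝ → ℝ}
    (hzm : ∀ᶠ δ : ℝ in 𝓝[>] 0, zm δ ∈ (Gm δ).faces ∧ (δ : ℂ) * hexCenter (zm δ) ∈ R.carrier)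
    (hzp : ∀ᶠ δ : ℝ in 𝓝[>] 0, zp δ ∈ (Gp δ).faces ∧ (δ : ℂ) * hexCenter (zp δ) ∈ R.carrier)
    (hztm : Tendsto (fun δ : ℝ => (δ : ℂ) * hexCenter (zm δ)) (𝓝[>] 0) (𝓝 (R.pt 3)))
    (hztp : Tendsto (fun δ : ℝ => (δ : ℂ) * hexCenter (zp δ)) (𝓝[>] 0) (𝓝 (R.pt 3)))
    (he : Tendsto e (𝓝[>] 0) (𝓝 0))
    (hsand : ∀ᶠ δ : ℝ in 𝓝[>] 0,
      (Gm δ).dropLast.clSepProb ChayesLeiHexPercolation.triBondCritical 1 (zm δ) - e δ ≤ Q δ ∧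
        Q δ ≤ (Gp δ).dropLast.clSepProb ChayesLeiHexPercolation.triBondCritical 1 (zp δ) + e δ) :
    ∃ (Sm Sp : ℝ → Finset ℂ) (fm fp : ℝ → Fin 3 → ℂ → ℝ),
      IsSeparatingData R triOmega Sm fm ∧ IsSeparatingData R triOmega Sp fp ∧
        ∃ (zm zp : ℝ → ℂ) (e : ℝ → ℝ),
          (∀ᶠ δ in 𝓝[>] (0 : ℝ),
              zm δ ∈ Sm δ ∧ zm δ ∈ R.carrier ∧ zp δ ∈ Sp δ ∧ zp δ ∈ R.carrier) ∧
            Tendsto zm (𝓝[>] 0) (𝓝 (R.pt 3)) ∧ Tendsto zp (𝓝[>] 0) (𝓝 (R.pt 3)) ∧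
              Tendsto e (𝓝[>] 0) (𝓝 0) ∧
                ∀ᶠ δ in 𝓝[>] (0 : ℝ), fm δ 1 (zm δ) - e δ ≤ Q δ ∧ Q δ ≤ fp δ 1 (zp δ) + e δ :=
  exists_separatingData_sandwich
    (exists_isSeparatingData_of_mesoscopicColourSwitching hMCS hGm h12m h198m h200m)
    (exists_isSeparatingData_of_mesoscopicColourSwitching hMCS hGp h12p h198p h200p)
    hzm hzp hztm hztp he hsand

end Summit.CriticalPhenomena.CardyFormulaZ2.Theorems

end
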